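import Summits.MatrixMultiplication.OmegaCensus.STPPVosperSlackTwoTablesZ59
import Summits.MatrixMultiplication.OmegaCensus.STPPVosperTilingWordsPrunedQ
import Summits.MatrixMultiplication.OmegaCensus.STPPVosperSlackTwoLawABQ

/-!
# ω-census (abelian STPP census): ℤ₅₉ leaf L3 — dead-table rows for case C (`tblZ59L3C`), part 2 of 4 (kernel computations)

HONEST FRAMING (pub-omega census; verbatim): lottery ticket; floor = certified bounds/negative ranges.
Census STRUCTURE (seat pub-omega-stpp-2 gen 27 — rows service for the stpp-1 lineage's law, 2026-08-29), family (b2).  For each entry `e = (Yo, Zo)` of stpp-1 g33's dead table `tblZ59L3C` (`STPPVosperSlackTwoTablesZ59.lean`, 64 entries) the words-cover search over the two other blocks returns `false` (SWAPPED orientation, WQ, blocks (2,3,3),(3,2,3); ≤ 26k steps each; soundness via `existsCoverW_both_of_isSTPP_enum`).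
Each theorem is ONE `decide +kernel` over a range of table entries.  Assembly in `STPPVosperSlackTwoRows59L3TblCAsm.lean`.  Nothing here is progress on `ω`.
-/

namespace Summit.MatrixMultiplication.OmegaCensus.CubeNB.S2

open Summit.MatrixMultiplication.OmegaCensus.CubeNB

/-- Dead-table entries `[18, 21)` of `tblZ59L3C`: the words-cover search fails. [folklore] -/
theorem dead59L3C_c6 : ∀ e ∈ (tblZ59L3C.drop 18).take 3, existsCoverW 59 e.2 e.1 [blockDiffsWQ 59 e.2 e.1 2 3 3, blockDiffsWQ 59 e.2 e.1 3 2 3] [] [] [] = false := by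
  decide +kernel

/-- Dead-table entries `[21, 24)` of `tblZ59L3C`: the words-cover search fails. [folklore] -/
theorem dead59L3C_c7 : ∀ e ∈ (tblZ59L3C.drop 21).take 3, existsCoverW 59 e.2 e.1 [blockDiffsWQ 59 e.2 e.1 2 3 3, blockDiffsWQ 59 e.2 e.1 3 2 3] [] [] [] = false := by
  decide +kernel

/-- Dead-table entries `[24, 27)` of `tblZ59L3C`: the words-cover search fails. [folklore] -/
theorem dead59L3C_c8 : ∀ e ∈ (tblZ59L3C.drop 24).take 3, existsCoverW 59 e.2 e.1 [blockDiffsWQ 59 e.2 e.1 2 3 3, blockDiffsWQ 59 e.2 e.1 3 2 3] [] [] [] = false := by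
  decide +kernel

/-- Dead-table entries `[27, 30)` of `tblZ59L3C`: the words-cover search fails. [folklore] -/
theorem dead59L3C_c9 : ∀ e ∈ (tblZ59L3C.drop 27).take 3, existsCoverW 59 e.2 e.1 [blockDiffsWQ 59 e.2 e.1 2 3 3, blockDiffsWQ 59 e.2 e.1 3 2 3] [] [] [] = false := by
  decide +kernel

/-- Dead-table entries `[30, 33)` of `tblZ59L3C`: the words-cover search fails. [folklore] -/
theorem dead59L3C_c10 : ∀ e ∈ (tblZ59L3C.drop 30).take 3, existsCoverW 59 e.2 e.1 [blockDiffsWQ 59 e.2 e.1 2 3 3, blockDiffsWQ 59 e.2 e.1 3 2 3] [] [] [] = false := by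
  decide +kernel

/-- Dead-table entries `[33, 36)` of `tblZ59L3C`: the words-cover search fails. [folklore] -/
theorem dead59L3C_c11 : ∀ e ∈ (tblZ59L3C.drop 33).take 3, existsCoverW 59 e.2 e.1 [blockDiffsWQ 59 e.2 e.1 2 3 3, blockDiffsWQ 59 e.2 e.1 3 2 3] [] [] [] = false := by
  decide +kernel

end Summit.MatrixMultiplication.OmegaCensus.CubeNB.S2
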